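import Summits.QuantumFields.YangMills.Theorems.UnitScaleTiltProp8ChartHInvComb
import Summits.QuantumFields.YangMills.Theorems.UnitScaleTiltProp8ChartHInvTent
import HarnessLib

/-!
# Route `UnitScaleTilt`, crux K1 «MinimiserStabilityRegPr» (stmt-QuantumFields-19200), leaf V2′ — the P2→P3 BRIDGE (hH of `ChartRemainderAt`),
# part C1: **THE RIGHT INVERSE `H X = H₀X̃′ + dφ` OF THE TRUE LINEARISATION `η·Q^{(j)}` FROM A RIGHT INVERSE `H₀` OF THE STRAIGHT AVERAGES,
# WITH THE WEIGHTED SUP LETTER — k-UNIFORMLY**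

Cell `ym3-torus`, seat `ym3-torus-p1` g18.  THE CONSTRUCTION (nested family `D`, (2.2)-admissible with `2L ≤ R·M + 1`; `H₀` any real right inverse of the
multi-level straight average `X ↦ (Q_jH₀X)(c) = X(j,c)` on the index bonds `𝔅 = ⋃_j Λ_j`, e.g. P2's flat `H = GQ*(QGQ*)⁻¹` (157)):
* corrected data `X̃′(j,c) = (L^jη)⁻¹·(X(j,c) + κ_j(c₊) − κ_j(c₋))`, `κ_j(y) = 0` if `y ∈ Ω_j^{(j)}`, else (a STRADDLING end-point, `j = i+1`) `κ_j(y) = λ̄_{X_i}(y)`,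
  the comb mean over `B(y)` of the level-`i` DATA read as a field on the `i`-bonds (`Xf`); a functional of the data alone;
* `Y = H₀ᴹX̃′` (the real kernel of `H₀` against the matrix data), so `Q_jY = X̃′` on `𝔅`;
* `φ(x) = Σ_{(j,y) ∈ 𝔅′} τ_{(j,y)}(x)·Λ_j(Y)(y)` — the hierarchical comb functional of part A at the SITE indices `𝔅′ = ⋃_j Λ_j` (sites), spread by the tents of
  part B; `H X = Y + dφ`.
THE IDENTITY `η·Q^{(j)}(HX)(c) = X(j,c)` on `𝔅` (`main_identity`): `Q^{(j)} = L^jQ_j − dΛ_j` and `Q^{(j)}(dφ) = d(φ∘embIter j)` (part A); at an end-point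
`y ∈ Λ_j` (sites) the tent sum pins `φ(embIter j y) = Λ_j(Y)(y)` (`phi_pin`), cancelling the comb; at a straddling end-point `u ∉ Ω_j^{(j)}` (`j = i+1`; by the
collar all `i`-blocks of `B(u)` lie in `Λ_i`, so `emb u` is pinned at level `i` and every staircase bond of `B(u)` is a NON-straddling index bond of level `i`)
the recursion `Λ_{i+1}(Y)(u) = L^i·λ̄_{Q_iY}(u) + Λ_i(Y)(emb u)` leaves `L^i·λ̄_{Q_iY}(u) = η⁻¹·λ̄_{X_i}(u)` — a functional of the DATA, which the correction `κ`
removes exactly (`straddle_defect`).  THE LETTER (`letter`): `w₁(b)·‖HX(b)‖ ≤ B₀(1+2C)(1+2C+2CL)·t` for `‖X‖_∞ ≤ t`, `C = (d+2)L`, from `H₀`'s weighted letter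
(P2's (46): `w₁(b)·|H₀X(b)| ≤ B₀·sup_c L^{j(c)}η|X(c)|`), the local size `‖Λ_j(Y)(y)‖ ≤ C·L^j·sup_{B^j(y)}‖Y‖`, the tents' slope `2/L^j`, and the territory collar
(the levels of the two end-points of a fine bond differ by `≤ 1`).  Packaged: `exists_rightInverse` (a ℂ-linear `H` with `η·Q^{(j)}(HX) = X` on `𝔅` and the
letter).  Theorems only; nothing of Bałaban's asserted.  NOT a claim about the mass gap.

References: T. Bałaban, CMP **102** (1985) 277–309 [Balaban1985Variational] ((45)–(46) p.285, (156)–(157) p.302, (161) p.303); CMP **98** (1985) 17–51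
[Balaban1985Averaging] ((62) p.28, (124)–(125) p.36); CMP **96** (1984) 223–250 [Balaban1984PropagatorsII] ((2.1)–(2.4) p.224, (2.20) p.226).
-/

noncomputable section

open scoped BigOperators Matrix.Norms.L2Operator

namespace Summit.QuantumFields.YangMills.Theorems.ChartHInv

open Literature.MathematicalPhysics.QuantumFieldTheory.Balaban1983to89
open T4Continuum BlockAveraging BlockAveragingEMLLinearised LatticeFieldCalculus
open B5Eq118OneStroke (iterBlockOf iterBlockOf_zero iterBlockOf_succ)
open B15DeterminingSets (embIter)
open B6SectADomainsV1 (Domains)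
open B6SectAOperatorsV1 (BondIdx SiteIdx)
open B11Eq115Space (levOf)
open Summit.QuantumFields.YangMills.Theorems.FlatCubeOpsText (Adm22)
open Summit.QuantumFields.YangMills.Theorems.Prop8Chart (collar_of_adm22)
open Summit.QuantumFields.YangMills.Theorems.Prop7CombGauge (combMean_add)
open Literature.MathematicalPhysics.QuantumFieldTheory.BalabanImbrieJaffe1984to88.BIJ88RT51Background (iterBlockOf_embIter)

variable {P : Params} {n : Type*}

section Construction

variable (D : Domains P) (η : ℝ)
  (Q : (i : ℕ) → (PBond P 0 → Matrix n n ℂ) → PBond P i → Matrix n n ℂ)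
  (hQ0 : ∀ Y, Q 0 Y = Y) (hQs : ∀ (i : ℕ) (Y : PBond P 0 → Matrix n n ℂ) (c : PBond P (i + 1)), Q (i + 1) Y c = linAvg (Q i Y) c)
  (Λ : (i : ℕ) → (PBond P 0 → Matrix n n ℂ) → Site P i → Matrix n n ℂ)
  (hΛ0 : ∀ Y y, Λ 0 Y y = 0)
  (hΛs : ∀ (i : ℕ) (Y : PBond P 0 → Matrix n n ℂ) (y : Site P (i + 1)), Λ (i + 1) Y y = (P.L ^ i : ℕ) • combMean (bondAvgIter i Y) y + Λ i Y (emb y))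
  -- the data as level fields, the end-point correction, the corrected data
  (Xf : (BondIdx D → Matrix n n ℂ) → (i : ℕ) → PBond P i → Matrix n n ℂ)
  (hXf : ∀ X i b, Xf X i b = if h : D.LamBond i b then X ⟨⟨⟨i, Nat.lt_succ_of_le (D.le_of_lamBond h)⟩, b⟩, h⟩ else 0)
  (κ : (BondIdx D → Matrix n n ℂ) → (j : ℕ) → Site P j → Matrix n n ℂ)
  (hκ0 : ∀ X y, κ X 0 y = 0)
  (hκs : ∀ X (i : ℕ) (y : Site P (i + 1)), κ X (i + 1) y = if y ∈ D.Om (i + 1) then 0 else combMean (Xf X i) y)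
  (Xt : (BondIdx D → Matrix n n ℂ) → BondIdx D → Matrix n n ℂ)
  (hXt : ∀ X idx, Xt X idx = (((P.L : ℝ) ^ (idx.1.1 : ℕ) * η)⁻¹) • (X idx + (κ X idx.1.1 idx.1.2.tgt - κ X idx.1.1 idx.1.2.src)))
  -- the straight right inverse and its matrix extension
  (H₀ : (BondIdx D → ℝ) →ₗ[ℝ] (PBond P 0 → ℝ)) (hinv : ∀ (X : BondIdx D → ℝ) (i : BondIdx D), bondAvgIter (i.1.1 : ℕ) (H₀ X) i.1.2 = X i)
  (Y : (BondIdx D → Matrix n n ℂ) → PBond P 0 → Matrix n n ℂ)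
  (hY : ∀ X b, Y X b = ∑ i : BondIdx D, H₀ (Pi.single i 1) b • Xt X i)
  -- the tents and the gauge function
  (τ : SiteIdx D → Site P 0 → ℝ)
  (hτ1 : ∀ s, τ s (embIter (s.1.1 : ℕ) s.1.2) = 1) (hτ0 : ∀ s x, iterBlockOf (s.1.1 : ℕ) x ≠ s.1.2 → τ s x = 0)
  (φ : (BondIdx D → Matrix n n ℂ) → Site P 0 → Matrix n n ℂ)
  (hφ : ∀ X x, φ X x = ∑ s : SiteIdx D, τ s x • Λ (s.1.1 : ℕ) (Y X) s.1.2)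

/-! ## §1 `Q_jY = X̃′` on the index bonds -/

include hinv hY in
/-- **THE MATRIX EXTENSION OF `H₀` IS A RIGHT INVERSE OF THE STRAIGHT AVERAGES**: `(Q_jY)(c) = X̃′(j,c)` at every index bond (`Q_j` commutes with the real
kernel; `Q_j(H₀δ_i) = δ_i`). [cite: Balaban1985Variational, (45) p.285; Balaban1984PropagatorsII, (2.20) p.226] -/
theorem bondAvgIter_Y (X : BondIdx D → Matrix n n ℂ) (idx : BondIdx D) : bondAvgIter (idx.1.1 : ℕ) (Y X) idx.1.2 = Xt X idx := by
  classical
  rw [show Y X = fun b => ∑ i : BondIdx D, H₀ (Pi.single i 1) b • Xt X i from funext (hY X), bondAvgIter_kernel_apply]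
  simp_rw [hinv]
  simp [Pi.single_apply]

/-! ## §2 The pins: `φ(embIter j y) = Λ_j(Y)(y)` at every site index `(j, y)` -/

include hτ1 hτ0 hφ in
/-- **THE TENT SUM PINS THE COMB FUNCTIONAL AT THE CENTRES OF THE SITE INDICES**: for `(j, y) ∈ 𝔅′` (`y ∈ Λ_j`), `φ(embIter j y) = Λ_j(Y)(y)` — the centre
`embIter j y` lies in `B^{j′}(y′)` for a site index `(j′, y′)` only if `(j′, y′) = (j, y)` (a fine site lies over exactly one `Λ_{j′}`, (2.4)).
[cite: Balaban1984PropagatorsII, (2.4) p.224] -/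
theorem phi_pin (X : BondIdx D → Matrix n n ℂ) (s : SiteIdx D) : φ X (embIter (s.1.1 : ℕ) s.1.2) = Λ (s.1.1 : ℕ) (Y X) s.1.2 := by
  classical
  rw [hφ, Finset.sum_eq_single s]
  · rw [hτ1, one_smul]
  · intro s' _ hs'
    have hj : (s.1.1 : ℕ) ≤ P.m + P.K := (D.le_of_lamSite s.2).trans D.hk
    rw [hτ0 s' _ ?_, zero_smul]
    intro heq
    apply hs'
    -- the territory of the centre is `s.1.1`, and also `s'.1.1`
    have hlev : levOf (fun i => {z : Site P 0 | D.InOm i z}) D.k (embIter (s.1.1 : ℕ) s.1.2) = (s.1.1 : ℕ) :=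
      FlatCubeLevels.levOf_inOm_unique D (by rw [iterBlockOf_embIter _ hj]; exact s.2)
    have hlev' : levOf (fun i => {z : Site P 0 | D.InOm i z}) D.k (embIter (s.1.1 : ℕ) s.1.2) = (s'.1.1 : ℕ) :=
      FlatCubeLevels.levOf_inOm_unique D (by rw [heq]; exact s'.2)
    have hjj : (s'.1.1 : ℕ) = (s.1.1 : ℕ) := hlev'.symm.trans hlev
    obtain ⟨⟨j', y'⟩, h'⟩ := s'
    obtain ⟨⟨j, y⟩, h⟩ := s
    simp only at hjj heq ⊢
    have hjF : j' = j := Fin.ext hjj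
    subst hjF
    rw [iterBlockOf_embIter _ hj] at heq
    subst heq
    rfl
  · intro h; exact absurd (Finset.mem_univ s) h

/-! ## §3 The defect at the end-points of an index bond -/

include hΛs hXf hκ0 hκs hXt hinv hY hτ1 hτ0 hφ in
/-- **THE END-POINT DEFECT IS THE DATA CORRECTION**: for an index bond `(j, c)` and either end-point `y` of `c`,
`Λ_j(Y)(y) − φ(embIter j y) = η⁻¹·κ_j(y)` — zero at a pinned end-point `y ∈ Λ_j`; at a straddling end-point `u ∉ Ω_j^{(j)}` (`j = i+1`, collar `2L ≤ RM + 1`)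
the recursion of `Λ` and the pin at `emb u ∈ Λ_i` leave `L^i·λ̄_{Q_iY}(u)`, and on the staircase bonds of `B(u)` — non-straddling index bonds of level `i` —
`Q_iY = (L^iη)⁻¹X_i`, so the defect is `η⁻¹·λ̄_{X_i}(u)`, a functional of the data. [cite: Balaban1985Averaging, (62) p.28; Balaban1984PropagatorsII, (2.2)-(2.4) p.224] -/
theorem endpoint_defect {R M : ℕ} (hAdm : Adm22 D R M) (hRM : 2 * P.L ≤ R * M + 1) (X : BondIdx D → Matrix n n ℂ)
    (idx : BondIdx D) {y : Site P (idx.1.1 : ℕ)} (hy : y = idx.1.2.src ∨ y = idx.1.2.tgt) :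
    Λ (idx.1.1 : ℕ) (Y X) y - φ X (embIter (idx.1.1 : ℕ) y) = (η⁻¹ : ℝ) • κ X (idx.1.1 : ℕ) y := by
  classical
  obtain ⟨⟨jF, c⟩, hc⟩ := idx
  simp only at hy ⊢
  have hnd : ¬ D.Deep (jF : ℕ) y := by rcases hy with rfl | rfl; exacts [hc.2.1, hc.2.2]
  by_cases hyin : y ∈ D.Om (jF : ℕ)
  · -- a pinned end-point
    have hpin := phi_pin D Λ Y τ hτ1 hτ0 φ hφ X ⟨⟨jF, y⟩, ⟨hyin, hnd⟩⟩
    simp only at hpin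
    rw [hpin, sub_self]
    -- the correction vanishes
    have hκ : κ X (jF : ℕ) y = 0 := by
      obtain ⟨j, hj⟩ := jF
      cases j with
      | zero => exact hκ0 X y
      | succ i => simp only at hyin ⊢; rw [hκs, if_pos hyin]
    rw [hκ, smul_zero]
  · -- a straddling end-point: the level is positive
    obtain ⟨j, hjlt⟩ := jF
    cases j with
    | zero => exact absurd (by rw [D.Om_zero]; exact Finset.mem_univ y) hyin
    | succ i =>
      simp only at hy hc hyin hnd ⊢
      have hi1 : i + 1 ≤ P.m + P.K := (D.le_of_lamBond hc).trans D.hk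
      -- the collar: the `i`-blocks of `B(y)` lie in `Ω_i`
      have hcollar := collar_of_adm22 D hAdm hRM i c hc
      have hyc : ∀ z : Site P i, blockOf z = y → z ∈ D.Om i := fun z hz =>
        hcollar z (by rcases hy with rfl | rfl; exacts [Or.inl hz, Or.inr hz])
      -- the pin at `emb y ∈ Λ_i`
      have hlam : D.LamSite i (emb y) := ⟨hyc _ (Site.blockOf_emb hi1 y), by
        show ¬ blockOf (emb y) ∈ D.Om (i + 1); rw [Site.blockOf_emb hi1]; exact hyin⟩
      have hpin := phi_pin D Λ Y τ hτ1 hτ0 φ hφ X ⟨⟨⟨i, by omega⟩, emb y⟩, hlam⟩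
      simp only at hpin
      rw [show embIter (i + 1) y = embIter i (emb y) from rfl, hpin, hΛs, add_sub_cancel_right, hκs, if_neg hyin]
      -- on the staircase bonds `Q_iY = (L^iη)⁻¹·X_i`
      have hstairs : ∀ (σ : Equiv.Perm (Fin P.d)) (r : Fin P.d → Fin P.L), ∀ s ∈ walk (emb y) (stairWord σ (off r)),
          bondAvgIter i (Y X) s.bond = (((P.L : ℝ) ^ i * η)⁻¹) • Xf X i s.bond := by
        intro σ r s hs
        have hb := blockOf_of_mem_walk_stairWord hi1 y σ r hs
        have hsrc : s.bond.src ∈ D.Om i := hyc _ hb.1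
        have htgt : s.bond.tgt ∈ D.Om i := hyc _ hb.2
        have hlb : D.LamBond i s.bond := ⟨Or.inl hsrc, by show ¬ blockOf s.bond.src ∈ D.Om (i + 1); rw [hb.1]; exact hyin,
          by show ¬ blockOf s.bond.tgt ∈ D.Om (i + 1); rw [hb.2]; exact hyin⟩
        have h1 := bondAvgIter_Y D Xt H₀ hinv Y hY X ⟨⟨⟨i, by omega⟩, s.bond⟩, hlb⟩
        simp only at h1
        rw [h1, hXt, hXf, dif_pos hlb]
        simp only
        -- the correction vanishes at both (non-straddling) end-points
        have hκs0 : κ X i s.bond.src = 0 ∧ κ X i s.bond.tgt = 0 := by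
          cases i with
          | zero => exact ⟨hκ0 X _, hκ0 X _⟩
          | succ i' => exact ⟨by rw [hκs, if_pos hsrc], by rw [hκs, if_pos htgt]⟩
        rw [hκs0.1, hκs0.2, sub_self, add_zero]
      rw [combMean_congr_stairs (Y' := fun b => (((P.L : ℝ) ^ i * η)⁻¹) • Xf X i b) y hstairs, combMean_real_smul, ← Nat.cast_smul_eq_nsmul ℝ, smul_smul]
      congr 1
      have hL : (P.L : ℝ) ^ i ≠ 0 := pow_ne_zero _ (Nat.cast_ne_zero.mpr P.L_pos.ne')
      rw [Nat.cast_pow, mul_inv, ← mul_assoc, mul_inv_cancel₀ hL, one_mul]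

/-! ## §4 The identity `η·Q^{(j)}(HX) = X` on `𝔅` -/

/-- Scalar bookkeeping: `η·(L^j·((L^jη)⁻¹·M)) − η·(η⁻¹·N) … `: `η • ((L^j : ℕ) • ((L^jη)⁻¹ • A) − η⁻¹ • B) = A − B`. [folklore] -/
theorem smul_bookkeeping (hη : η ≠ 0) (j : ℕ) (A B : Matrix n n ℂ) :
    (η : ℂ) • ((P.L ^ j : ℕ) • ((((P.L : ℝ) ^ j * η)⁻¹) • A) - (η⁻¹ : ℝ) • B) = A - B := by
  have hL : (P.L : ℝ) ^ j ≠ 0 := pow_ne_zero _ (Nat.cast_ne_zero.mpr P.L_pos.ne')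
  rw [← Nat.cast_smul_eq_nsmul ℝ, smul_smul, Nat.cast_pow, mul_inv, ← mul_assoc, mul_inv_cancel₀ hL, one_mul, ← Complex.coe_smul,
    ← Complex.coe_smul, smul_sub, smul_smul, smul_smul, ← Complex.ofReal_mul, mul_inv_cancel₀ hη]
  simp

include hQ0 hQs hΛ0 hΛs hXf hκ0 hκs hXt hinv hY hτ1 hτ0 hφ in
/-- **THE MAIN IDENTITY: `η·Q^{(j)}(Y + dφ)(c) = X(j, c)` AT EVERY INDEX BOND** — `Q^{(j)}Y = L^jQ_jY − dΛ_j(Y) = L^jX̃′ − dΛ_j(Y)`, `Q^{(j)}(dφ) = d(φ∘embIter j)`,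
and the two end-point defects are `η⁻¹κ_j`, which the corrected data carries. [cite: Balaban1985Variational, (45) p.285, (156)-(157) p.302] -/
theorem main_identity {R M : ℕ} (hAdm : Adm22 D R M) (hRM : 2 * P.L ≤ R * M + 1) (hη : η ≠ 0) (X : BondIdx D → Matrix n n ℂ) (idx : BondIdx D) :
    (η : ℂ) • Q (idx.1.1 : ℕ) (fun b => Y X b + (φ X b.tgt - φ X b.src)) idx.1.2 = X idx := by
  have hsrc := endpoint_defect D η Λ hΛs Xf hXf κ hκ0 hκs Xt hXt H₀ hinv Y hY τ hτ1 hτ0 φ hφ hAdm hRM X idx (Or.inl rfl)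
  have htgt := endpoint_defect D η Λ hΛs Xf hXf κ hκ0 hκs Xt hXt H₀ hinv Y hY τ hτ1 hτ0 φ hφ hAdm hRM X idx (Or.inr rfl)
  rw [linFamily_add Q hQ0 hQs, linFamily_eq_sub_comb Q hQ0 hQs Λ hΛ0 hΛs, linFamily_grad Q hQ0 hQs, bondAvgIter_Y D Xt H₀ hinv Y hY,
    show (P.L ^ (idx.1.1 : ℕ) : ℕ) • Xt X idx - (Λ (idx.1.1 : ℕ) (Y X) idx.1.2.tgt - Λ (idx.1.1 : ℕ) (Y X) idx.1.2.src) +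
        (φ X (embIter (idx.1.1 : ℕ) idx.1.2.tgt) - φ X (embIter (idx.1.1 : ℕ) idx.1.2.src)) =
      (P.L ^ (idx.1.1 : ℕ) : ℕ) • Xt X idx - ((Λ (idx.1.1 : ℕ) (Y X) idx.1.2.tgt - φ X (embIter (idx.1.1 : ℕ) idx.1.2.tgt)) -
        (Λ (idx.1.1 : ℕ) (Y X) idx.1.2.src - φ X (embIter (idx.1.1 : ℕ) idx.1.2.src))) by abel,
    hsrc, htgt, ← smul_sub, hXt, smul_bookkeeping η hη]
  abel

/-! ## §6 Linearity of `X ↦ HX` -/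

section Linear

include hXf in
/-- `Xf` is additive in the data. [cite: Balaban1984PropagatorsII, (2.20) p.226] -/
theorem Xf_add (X X' : BondIdx D → Matrix n n ℂ) (i : ℕ) (b : PBond P i) : Xf (X + X') i b = Xf X i b + Xf X' i b := by
  rw [hXf, hXf, hXf]; split_ifs <;> simp

include hXf in
/-- `Xf` commutes with complex scalars. [cite: Balaban1984PropagatorsII, (2.20) p.226] -/
theorem Xf_smul (a : ℂ) (X : BondIdx D → Matrix n n ℂ) (i : ℕ) (b : PBond P i) : Xf (a • X) i b = a • Xf X i b := by
  rw [hXf, hXf]; split_ifs <;> simp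

include hXf hκ0 hκs in
/-- `κ` is additive in the data. [cite: Balaban1985Averaging, (62) p.28] -/
theorem kappa_add (X X' : BondIdx D → Matrix n n ℂ) : ∀ (j : ℕ) (y : Site P j), κ (X + X') j y = κ X j y + κ X' j y
  | 0, y => by rw [hκ0, hκ0, hκ0, add_zero]
  | i + 1, y => by
    rw [hκs, hκs, hκs]
    split_ifs
    · rw [add_zero]
    · rw [show Xf (X + X') i = fun b => Xf X i b + Xf X' i b from funext (Xf_add D Xf hXf X X' i), combMean_add]

include hXf hκ0 hκs in
/-- `κ` commutes with complex scalars. [cite: Balaban1985Averaging, (62) p.28] -/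
theorem kappa_smul (a : ℂ) (X : BondIdx D → Matrix n n ℂ) : ∀ (j : ℕ) (y : Site P j), κ (a • X) j y = a • κ X j y
  | 0, y => by rw [hκ0, hκ0, smul_zero]
  | i + 1, y => by
    rw [hκs, hκs]
    split_ifs
    · rw [smul_zero]
    · rw [show Xf (a • X) i = fun b => a • Xf X i b from funext (Xf_smul D Xf hXf a X i), combMean_const_smul]

include hXf hκ0 hκs hXt in
/-- `X̃′` is additive. [cite: Balaban1985Variational, (156) p.302] -/
theorem Xt_add (X X' : BondIdx D → Matrix n n ℂ) (idx : BondIdx D) : Xt (X + X') idx = Xt X idx + Xt X' idx := by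
  rw [hXt, hXt, hXt, kappa_add D Xf hXf κ hκ0 hκs, kappa_add D Xf hXf κ hκ0 hκs, Pi.add_apply, ← smul_add]
  congr 1; abel

include hXf hκ0 hκs hXt in
/-- `X̃′` commutes with complex scalars. [cite: Balaban1985Variational, (156) p.302] -/
theorem Xt_smul (a : ℂ) (X : BondIdx D → Matrix n n ℂ) (idx : BondIdx D) : Xt (a • X) idx = a • Xt X idx := by
  rw [hXt, hXt, kappa_smul D Xf hXf κ hκ0 hκs, kappa_smul D Xf hXf κ hκ0 hκs, Pi.smul_apply, ← smul_sub, ← smul_add, smul_comm]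

include hXf hκ0 hκs hXt hY in
/-- `Y` is additive. [cite: Balaban1985Variational, (157) p.302] -/
theorem Y_add (X X' : BondIdx D → Matrix n n ℂ) (b : PBond P 0) : Y (X + X') b = Y X b + Y X' b := by
  rw [hY, hY, hY, ← Finset.sum_add_distrib]
  refine Finset.sum_congr rfl fun i _ => ?_
  rw [Xt_add D η Xf hXf κ hκ0 hκs Xt hXt, smul_add]

include hXf hκ0 hκs hXt hY in
/-- `Y` commutes with complex scalars. [cite: Balaban1985Variational, (157) p.302] -/
theorem Y_smul (a : ℂ) (X : BondIdx D → Matrix n n ℂ) (b : PBond P 0) : Y (a • X) b = a • Y X b := by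
  rw [hY, hY, Finset.smul_sum]
  refine Finset.sum_congr rfl fun i _ => ?_
  rw [Xt_smul D η Xf hXf κ hκ0 hκs Xt hXt, smul_comm]

include hΛ0 hΛs hXf hκ0 hκs hXt hY hφ in
/-- `φ` is additive. [cite: Balaban1985Averaging, (62) p.28] -/
theorem phi_add (X X' : BondIdx D → Matrix n n ℂ) (x : Site P 0) : φ (X + X') x = φ X x + φ X' x := by
  rw [hφ, hφ, hφ, ← Finset.sum_add_distrib]
  refine Finset.sum_congr rfl fun s _ => ?_
  rw [show Y (X + X') = fun b => Y X b + Y X' b from funext (Y_add D η Xf hXf κ hκ0 hκs Xt hXt H₀ Y hY X X'),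
    combFamily_add Λ hΛ0 hΛs, smul_add]

include hΛ0 hΛs hXf hκ0 hκs hXt hY hφ in
/-- `φ` commutes with complex scalars. [cite: Balaban1985Averaging, (62) p.28] -/
theorem phi_smul (a : ℂ) (X : BondIdx D → Matrix n n ℂ) (x : Site P 0) : φ (a • X) x = a • φ X x := by
  rw [hφ, hφ, Finset.smul_sum]
  refine Finset.sum_congr rfl fun s _ => ?_
  rw [show Y (a • X) = fun b => a • Y X b from funext (Y_smul D η Xf hXf κ hκ0 hκs Xt hXt H₀ Y hY a X),
    combFamily_const_smul Λ hΛ0 hΛs, smul_comm]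

end Linear


end Construction


end Summit.QuantumFields.YangMills.Theorems.ChartHInv

end
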